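import Mathlib
import Summits.Ventures.PercRepro2.PMK5LocusFace
import Summits.Ventures.PercRepro2.PMK5LocusZero
import Summits.Ventures.PercRepro2.PMK5LocusSS
import Summits.Ventures.PercRepro2.PMK5LocusGroupL

/-!
# THE EQUALITY LOCUS OF THE OPEN HALF `groupL` ON FIVE-VERTEX BASES — THE ZERO SIDE AND THE TWO «IFF»s
(blind cell PercRepro2, mine-2 g56; on `PMK5LocusGroupL.lean` (the certificate, the bridge, the positive side,
`RuleG2 = RuleB ∪ RuleSS`) and the restricted-table machinery of `PMK5LocusFace.lean`; `conjectures/MINE-2.md` M2-126)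

The `groupL`-degenerate edge sets form a down-set with FIVE maximal elements `MxGL = {442, 503, 637, 926, 1011}`
(`K₅ − {oa₁, ou, a₁b, ub}`, `K₅ − {ob, ub}`, `K₅ − {oa₂, a₂u, a₂b}`, `K₅ − {oa₁, a₁u, a₁b}`, `K₅ − {ou, ob}`; `coverZGL`);
the restricted Kronecker numbers agree on each (`faceGL_*`, five `decide +kernel`), so every coefficient supported inside a
degenerate face vanishes (`coefGL_eq_of_face`), whence **`groupL_K5_zero_of_face`** and the «iff»s **`groupL_K5_pos_iff`** /
**`groupL_K5_zero_iff`**: on `K₅` the open half of the leaf row vanishes identically on the face of an edge set exactly when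
the root pair separates `o` from `b`, or `a₁` cannot reach `o` avoiding `a₂`, or `a₂` can reach neither `o` nor `u` avoiding
`a₁`, or `o` reaches neither root.  Standard axioms.
-/

namespace Summit.Ventures.PercRepro2

open Hub CovForm

namespace K5

namespace PM

/-- The positive part of `groupL` on the face `m`. -/
def kPosGLm (m : ℕ) : ℕ := kp (restr m tQ) (restr m tQ) (restr m tQBLHuoU) +
  kp (restr m tQoU) (restr m tQBL) (restr m tQHu) + kp (restr m tQ) (restr m tQBL) (restr m tQHo)
/-- The negative part of `groupL` on the face `m`. -/
def kNegGLm (m : ℕ) : ℕ := kp (restr m tQ) (restr m tQBL) (restr m tQHuoU) +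
  kp (restr m tQoU) (restr m tQ) (restr m tQBLHu) + kp (restr m tQ) (restr m tQ) (restr m tQBLHo)
/-- The positive triple counts of `groupL` on the face `m`. -/
def cntPosGLm (m : ℕ) (k : Fin 10 → Fin 4) : ℕ := cnt3 (restr m tQ) (restr m tQ) (restr m tQBLHuoU) k +
  cnt3 (restr m tQoU) (restr m tQBL) (restr m tQHu) k + cnt3 (restr m tQ) (restr m tQBL) (restr m tQHo) k
/-- The negative triple counts of `groupL` on the face `m`. -/
def cntNegGLm (m : ℕ) (k : Fin 10 → Fin 4) : ℕ := cnt3 (restr m tQ) (restr m tQBL) (restr m tQHuoU) k +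
  cnt3 (restr m tQoU) (restr m tQ) (restr m tQBLHu) k + cnt3 (restr m tQ) (restr m tQ) (restr m tQBLHo) k

/-- `kPosGLm` carries the restricted positive counts. -/
lemma kPosGLm_eq (m : ℕ) : kPosGLm m = ∑ k, cntPosGLm m k * KB ^ idx4 k :=
  ((congrArg₂ (· + ·) (congrArg₂ (· + ·) (kp_eq _ _ _) (kp_eq _ _ _)) (kp_eq _ _ _)).trans
    (sum3 (cnt3 (restr m tQ) (restr m tQ) (restr m tQBLHuoU)) (cnt3 (restr m tQoU) (restr m tQBL) (restr m tQHu))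
      (cnt3 (restr m tQ) (restr m tQBL) (restr m tQHo))))
/-- `kNegGLm` carries the restricted negative counts. -/
lemma kNegGLm_eq (m : ℕ) : kNegGLm m = ∑ k, cntNegGLm m k * KB ^ idx4 k :=
  ((congrArg₂ (· + ·) (congrArg₂ (· + ·) (kp_eq _ _ _) (kp_eq _ _ _)) (kp_eq _ _ _)).trans
    (sum3 (cnt3 (restr m tQ) (restr m tQBL) (restr m tQHuoU)) (cnt3 (restr m tQoU) (restr m tQ) (restr m tQBLHu))
      (cnt3 (restr m tQ) (restr m tQ) (restr m tQBLHo))))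
/-- The restricted positive counts are below `2^19`. -/
lemma cntPosGLm_lt (m : ℕ) (k : Fin 10 → Fin 4) : cntPosGLm m k < 2 ^ 19 := by
  unfold cntPosGLm
  have h1 := cnt3_le (restr m tQ) (restr m tQ) (restr m tQBLHuoU) k
  have h2 := cnt3_le (restr m tQoU) (restr m tQBL) (restr m tQHu) k
  have h3 := cnt3_le (restr m tQ) (restr m tQBL) (restr m tQHo) k
  omega
/-- The restricted negative counts are below `2^19`. -/
lemma cntNegGLm_lt (m : ℕ) (k : Fin 10 → Fin 4) : cntNegGLm m k < 2 ^ 19 := by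
  unfold cntNegGLm
  have h1 := cnt3_le (restr m tQ) (restr m tQBL) (restr m tQHuoU) k
  have h2 := cnt3_le (restr m tQoU) (restr m tQ) (restr m tQBLHu) k
  have h3 := cnt3_le (restr m tQ) (restr m tQ) (restr m tQBLHo) k
  omega

/-! ## The five maximal `groupL`-degenerate faces (kernel) -/

set_option maxRecDepth 100000 in
/-- The restricted numbers of `groupL` agree on the face `442` = {oa2 ob a1a2 a1u a2u a2b}. -/
theorem faceGL_442 : kPosGLm 442 = kNegGLm 442 := by
  decide +kernel

set_option maxRecDepth 100000 in
/-- The restricted numbers of `groupL` agree on the face `503` = {oa1 oa2 ou a1a2 a1u a1b a2u a2b}. -/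
theorem faceGL_503 : kPosGLm 503 = kNegGLm 503 := by
  decide +kernel

set_option maxRecDepth 100000 in
/-- The restricted numbers of `groupL` agree on the face `637` = {oa1 ou ob a1a2 a1u a1b ub}. -/
theorem faceGL_637 : kPosGLm 637 = kNegGLm 637 := by
  decide +kernel

set_option maxRecDepth 100000 in
/-- The restricted numbers of `groupL` agree on the face `926` = {oa2 ou ob a1a2 a2u a2b ub}. -/
theorem faceGL_926 : kPosGLm 926 = kNegGLm 926 := by
  decide +kernel

set_option maxRecDepth 100000 in
/-- The restricted numbers of `groupL` agree on the face `1011` = {oa1 oa2 a1a2 a1u a1b a2u a2b ub}. -/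
theorem faceGL_1011 : kPosGLm 1011 = kNegGLm 1011 := by
  decide +kernel

/-- **Every coefficient of `groupL` supported inside a face with equal restricted numbers vanishes.** -/
theorem coefGL_eq_of_face (m : ℕ) (hz : kPosGLm m = kNegGLm m) (k : Fin 10 → Fin 4)
    (hk : ∀ e : Fin 10, k e ≠ 0 → m.testBit e = true) : cntPosGL k = cntNegGL k := by
  have h := eq_of_kron_eq _ _ (cntPosGLm_lt m) (cntNegGLm_lt m) (kPosGLm_eq m) (kNegGLm_eq m) hz k
  unfold cntPosGLm cntNegGLm at h
  simp only [cnt3_restr_eq hk] at h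
  unfold cntPosGL cntNegGL
  omega

/-- The five maximal `groupL`-degenerate edge sets. -/
def MxGL : Fin 5 → ℕ := ![442, 503, 637, 926, 1011]

set_option maxRecDepth 100000 in
/-- **Every `groupL`-degenerate edge set lies inside one of the five maximal ones.** -/
theorem coverZGL : ∀ m : Fin 1024, RuleG2 m = true →
    ∃ i : Fin 5, ∀ e : Fin 10, (m : ℕ).testBit e = true → (MxGL i).testBit e = true := by
  decide +kernel

/-- The restricted numbers agree on each maximal `groupL`-degenerate face. -/
theorem faceGL_all : ∀ i : Fin 5, kPosGLm (MxGL i) = kNegGLm (MxGL i) := by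
  intro i
  fin_cases i
  exacts [faceGL_442, faceGL_503, faceGL_637, faceGL_926, faceGL_1011]

section Face

variable {R : Type*} [Field R] [LinearOrder R] [IsStrictOrderedRing R]

omit [LinearOrder R] [IsStrictOrderedRing R] in
/-- **THE EQUALITY LOCUS OF THE OPEN HALF — THE ZERO SIDE (Bernstein form).** -/
theorem groupL_K5_zero_of_face (m : ℕ) (hm : m < 1024) (hr : RuleG2 m = true) (q : Fin 10 → R)
    (hq₀ : ∀ e : Fin 10, m.testBit e = false → q e = 0) :
    ∑ k, bern q k * ((cntPosGL k : ℕ) - (cntNegGL k : ℕ) : R) = 0 := by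
  refine Finset.sum_eq_zero fun k _ => ?_
  by_cases hk : ∀ e : Fin 10, k e ≠ 0 → m.testBit e = true
  · obtain ⟨i, hi⟩ := coverZGL ⟨m, hm⟩ hr
    have hc := coefGL_eq_of_face (MxGL i) (faceGL_all i) k fun e he => hi e (hk e he)
    rw [hc, sub_self, mul_zero]
  · obtain ⟨e, he⟩ := not_forall.1 hk
    obtain ⟨hke, hme⟩ := Classical.not_imp.1 he
    have hqe : q e = 0 := hq₀ e (by simpa using hme)
    have hb : bern q k = 0 := by
      unfold bern
      apply Finset.prod_eq_zero (Finset.mem_univ e)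
      rw [hqe, zero_pow (fun h => hke (Fin.ext (by simpa using h)))]
      simp
    rw [hb, zero_mul]

/-- **THE EQUALITY LOCUS OF `groupL`, FIRST «IFF»**: `groupL > 0` at every weight vector interior on `m` ⟺ `m` is not
`groupL`-degenerate (`RuleB ∪ RuleSS`). -/
theorem groupL_K5_pos_iff (m : ℕ) (hm : m < 1024) :
    (∀ q : Fin 10 → R, (∀ e : Fin 10, m.testBit e = true → 0 < q e ∧ q e < 1) →
      (∀ e : Fin 10, m.testBit e = false → q e = 0) →
      0 < ∑ k, bern q k * ((cntPosGL k : ℕ) - (cntNegGL k : ℕ) : R)) ↔ RuleG2 m = false := by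
  constructor
  · intro h
    rcases Bool.eq_false_or_eq_true (RuleG2 m) with hr | hr
    · exfalso
      have hpos := h (centre (R := R) m) (fun e he => centre_on_pos he) (fun e he => centre_off he)
      have hzero := groupL_K5_zero_of_face m hm hr (centre (R := R) m) (fun e he => centre_off he)
      rw [hzero] at hpos
      exact lt_irrefl _ hpos
    · exact hr
  · intro hr q hq₁ hq₀
    exact groupL_K5_pos_of_face m hm hr q hq₁ hq₀

/-- **THE EQUALITY LOCUS OF `groupL`, SECOND «IFF»**: `groupL = 0` at every admissible weight vector supported on `m` ⟺
`m` is `groupL`-degenerate. -/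
theorem groupL_K5_zero_iff (m : ℕ) (hm : m < 1024) :
    (∀ q : Fin 10 → R, (∀ e : Fin 10, 0 ≤ q e ∧ q e ≤ 1) →
      (∀ e : Fin 10, m.testBit e = false → q e = 0) →
      ∑ k, bern q k * ((cntPosGL k : ℕ) - (cntNegGL k : ℕ) : R) = 0) ↔ RuleG2 m = true := by
  constructor
  · intro h
    rcases Bool.eq_false_or_eq_true (RuleG2 m) with hr | hr
    · exact hr
    · exfalso
      have hpos := groupL_K5_pos_of_face m hm hr (centre (R := R) m)
        (fun e he => centre_on_pos he) (fun e he => centre_off he)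
      have hzero := h (centre (R := R) m) (centre_01 m) (fun e he => centre_off he)
      rw [hzero] at hpos
      exact lt_irrefl _ hpos
  · intro hr q _ hq₀
    exact groupL_K5_zero_of_face m hm hr q hq₀

end Face

end PM

end K5

end Summit.Ventures.PercRepro2
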